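import Literature.NumberTheory.Automorphic.UnitaryGroupKernelClassUnipotent
import Literature.NumberTheory.Automorphic.UnitaryGroupKernelBorelClassHomogeneity
import HarnessLib

/-!
# The class Borel kernel of `U(J₃)` at the central class `z · 𝒰(F)` has the single torus fibre `z·1`:
# `K_{B,𝔬}(x, y) = ν(𝓕)⁻¹ ∫_{N(𝔸_F)} f(x⁻¹ z₁ m y) dν(m)`
(Rogawski, *Automorphic Representations of Unitary Groups in Three Variables* (1990), §2.2 p. 13:
`K_{P,𝔬}(x, y) = Σ_{γ ∈ M_P ∩ 𝔬̲′} ∫_{𝐍_P} f(x⁻¹ γ n y) dn`; §7.3 p. 95: the term `∫_𝐍 f(g⁻¹ γ n g) dn` of the unipotent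
contribution; proof of Prop. 7.2.1 p. 92: «since `γ` is singular, `𝔬_st ∩ M = {γ}`».)

Topic `NumberTheory/Automorphic`; namespace `Literature.NumberTheory.Automorphic.UnitaryGroup`. THEOREMS ONLY
over accepted tree modules (no definition, no named fact, no instance, no notation, no `sorry`). Item (L5-i)
«the unipotent term `P_{z·𝒰}`» of the T1-qs LAW 5 road of `Cruxes/H413/Lines/F0_T1InnerFormTraceIdentity.lean`
(cell `pub/hodgecm-mathlib`, crux H413), B0 FILE 4, sequel of ★ `UnitaryGroupKernelClassUnipotent`
(`z ∈ E¹`, `z₁ = toAdelic (z·1)`, fibre `{charpoly = (X − z)³ ⊗ 𝔸_E}`).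

* §1 `coe_eq_toAdelic_ratCenter_of_charpoly_eq` — the TORUS CELL of the class is the single point `z·1`: a
  rational torus element with `charpoly = (X − z)³ ⊗ 𝔸_E` IS `z·1` (diagonal with `charpoly (X − z)³`).
* §2 **`kernelBorelClass_eq_smul_integral_central`** — `K_{B,𝔬}(x, y) = ν(𝓕)⁻¹ ∫_{N(𝔸_F)} f(x⁻¹ z₁ m y) dν(m)`
  for `f ∈ C_c(G(𝔸_F))`, any Haar measure `ν` of `N(𝔸_F)` and fundamental domain `𝓕` of `N(F)`, `cl` constant
  along `N(F)` on `B(F)` (★ `kernelBorelClass_eq_smul_tsum_integral` — Rogawski's printed `K_{B,𝔬}` — with the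
  one-point torus cell of §1).

## References

* J. D. Rogawski, *Automorphic Representations of Unitary Groups in Three Variables*, Annals of
  Mathematics Studies 123 (1990), §2.2 (p. 13), Prop. 7.2.1 (pp. 91–92), §7.3 (p. 95) [Rogawski1990].
* J. Arthur, *A trace formula for reductive groups I*, Duke Math. J. 45 (1978), §8 [Arthur1978TraceFormulaI].
-/

set_option autoImplicit false

noncomputable section

open NumberField IsDedekindDomain Matrix Polynomial MeasureTheory
open scoped MatrixGroups

namespace Literature.NumberTheory.Automorphic

namespace UnitaryGroup

variable {F E : Type} [Field F] [NumberField F] [Field E] [NumberField E] [Algebra F E]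
  {c : E ≃ₐ[F] E} {ι : Type*}

/-! ## §1 The torus cell of the class `(X − z)³` is the single point `z·1` -/

/-- **A rational TORUS element of the class `(X − z)³` is `z·1`** (`z ∈ E¹`): its rational matrix is diagonal
(off-diagonal entries are principal adeles equal to `0`) with `charpoly = (X − z)³`, so every diagonal entry
is `z` (★ `apply_self_eq_of_blockTriangular_of_charpoly_eq`) — «since `γ` is singular, `𝔬_st ∩ M = {γ}`»
[Rogawski1990, proof of Prop. 7.2.1, p. 92], central case. [cite: Rogawski1990, Prop. 7.2.1 (pp. 91–92)] -/
theorem coe_eq_toAdelic_ratCenter_of_charpoly_eq (ζ : ratOne F E c) {t : rationalTorus F E c 3}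
    (ht : ((adelicVal F E c 3 _ (((t : rationalTorus F E c 3) : torusAdelic F E c 3) :
        (quasiSplit F E c 3).Adelic) : GL (Fin 3) (AdeleRing (𝓞 E) E)) :
        Matrix (Fin 3) (Fin 3) (AdeleRing (𝓞 E) E)).charpoly =
      ((X - C ((ζ : Eˣ) : E)) ^ 3).map (algebraMap E (AdeleRing (𝓞 E) E))) :
    (((t : rationalTorus F E c 3) : torusAdelic F E c 3) : (quasiSplit F E c 3).Adelic) =
      (quasiSplit F E c 3).toAdelic (ratCenter F E c 3 ((StdForm.antidiagonal 3).over E) ζ) := by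
  obtain ⟨t₀, ht₀⟩ := (show (((t : rationalTorus F E c 3) : torusAdelic F E c 3) : (quasiSplit F E c 3).Adelic) ∈
    (quasiSplit F E c 3).arithmeticSubgroup from t.2)
  -- the rational matrix `T₀` of `t₀` is diagonal
  obtain ⟨d, -, hd⟩ := (mem_torusAdelic_iff _).1 ((t : rationalTorus F E c 3) : torusAdelic F E c 3).2
  set T₀ : Matrix (Fin 3) (Fin 3) E := ((t₀.1 : GL (Fin 3) E) : Matrix (Fin 3) (Fin 3) E) with hT₀
  have hmap : T₀.map (algebraMap E (AdeleRing (𝓞 E) E)) =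
      ((glDiagonal 3 (AdeleRing (𝓞 E) E) d : GL (Fin 3) (AdeleRing (𝓞 E) E)) :
        Matrix (Fin 3) (Fin 3) (AdeleRing (𝓞 E) E)) := by
    rw [hd, ← ht₀]; rfl
  have hoff : ∀ i j, i ≠ j → T₀ i j = 0 := by
    intro i j hij
    have h := congrFun (congrFun hmap i) j
    rw [Matrix.map_apply, coe_glDiagonal, Matrix.diagonal_apply_ne _ hij] at h
    exact (map_eq_zero_iff _ (AdeleRing.algebraMap_injective (𝓞 E) E)).1 h
  have hB : T₀.BlockTriangular id := fun i j hij => hoff i j (ne_of_gt hij)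
  -- its characteristic polynomial is `(X − z)³`, hence all diagonal entries are `z`
  have hchar₀ : T₀.charpoly = (X - C ((ζ : Eˣ) : E)) ^ 3 :=
    charpoly_eq_of_toAdelic_eq (γ := ⟨_, t₀, ht₀⟩) ht₀ ht
  have hdiag : ∀ i, T₀ i i = ((ζ : Eˣ) : E) := apply_self_eq_of_blockTriangular_of_charpoly_eq hB hchar₀
  -- so `t₀ = z·1`
  have ht₀eq : t₀ = ratCenter F E c 3 ((StdForm.antidiagonal 3).over E) ζ := by
    refine Subtype.ext (Units.ext ?_)
    change T₀ = (((ratCenter F E c 3 ((StdForm.antidiagonal 3).over E) ζ : rational F E c 3 _) :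
      GL (Fin 3) E) : Matrix (Fin 3) (Fin 3) E)
    rw [coe_ratCenter]
    ext i j
    by_cases hij : i = j
    · subst hij; simp [hdiag]
    · simp [hoff i j hij, hij]
  rw [← ht₀, ht₀eq]

/-! ## §2 `K_{B,𝔬}(x, y) = ν(𝓕)⁻¹ ∫_{N(𝔸_F)} f(x⁻¹ z₁ m y) dν(m)` at the central class -/

section KernelBorelClass

variable [MeasurableSpace (adelicUnipotent F E c 3)] [BorelSpace (adelicUnipotent F E c 3)]

/-- **`K_{B,𝔬}(x, y) = ν(𝓕)⁻¹ ∫_{N(𝔸_F)} f(x⁻¹ · z₁ · m · y) dν(m)` FOR THE CLASS OF `z · 𝒰(F)`** (`z ∈ E¹`,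
`z₁ = toAdelic (z·1)`): Rogawski's `K_{B,𝔬}(x, y) = Σ_{t ∈ T(F) ∩ 𝔬} ∫_𝐍 f(x⁻¹ t n y) dn` (★
`kernelBorelClass_eq_smul_tsum_integral`, for `f ∈ C_c(G(𝔸_F))`, any Haar measure `ν` of `N(𝔸_F)` and
fundamental domain `𝓕` of `N(F)`, `cl` constant along `N(F)` on `B(F)`) has ONE term, `t = z·1` (§1), for a class
map whose fibre at `i` is `{charpoly = (X − z)³ ⊗ 𝔸_E}` — the integrand `∫_𝐍 f(g⁻¹ γ n g) dn` of
[Rogawski1990, §7.3 p. 95] before the `K`- and `M`-integrations. [cite: Rogawski1990, §2.2 (p. 13)]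
[cite: Rogawski1990, §7.3 (p. 95)] -/
theorem kernelBorelClass_eq_smul_integral_central {cl : (quasiSplit F E c 3).arithmeticSubgroup → ι}
    (ν : Measure (adelicUnipotent F E c 3)) [ν.IsHaarMeasure]
    {𝓕 : Set (adelicUnipotent F E c 3)} (h𝓕 : IsFundamentalDomain (rationalUnipotent F E c 3) 𝓕 ν)
    (hclN : IsUnipotentInvariantOnBorel F E c 3 cl) (ζ : ratOne F E c) {i : ι}
    (hcl : ∀ γ : (quasiSplit F E c 3).arithmeticSubgroup, cl γ = i ↔
      ((adelicVal F E c 3 _ (γ : (quasiSplit F E c 3).Adelic) : GL (Fin 3) (AdeleRing (𝓞 E) E)) :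
          Matrix (Fin 3) (Fin 3) (AdeleRing (𝓞 E) E)).charpoly =
        ((X - C ((ζ : Eˣ) : E)) ^ 3).map (algebraMap E (AdeleRing (𝓞 E) E)))
    {f : (quasiSplit F E c 3).Adelic → ℂ} (hfc : Continuous f) (hf : HasCompactSupport f)
    (x y : (quasiSplit F E c 3).Adelic) :
    kernelBorelClass ν 𝓕 cl i f x y = ((ν 𝓕).toReal⁻¹ : ℝ) •
      ∫ m : adelicUnipotent F E c 3,
        f (x⁻¹ * (quasiSplit F E c 3).toAdelic (ratCenter F E c 3 ((StdForm.antidiagonal 3).over E) ζ) *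
          ((m : adelicUnipotent F E c 3) : (quasiSplit F E c 3).Adelic) * y) ∂ν := by
  rw [kernelBorelClass_eq_smul_tsum_integral ν h𝓕 hclN hfc hf x y i]
  congr 1
  -- the index subtype `{t ∈ T(F) : cl t = i}` is the singleton `{z·1}`
  set zR := ratCenter F E c 3 ((StdForm.antidiagonal 3).over E) ζ with hzR
  have hzT : (quasiSplit F E c 3).toAdelic zR ∈ torusAdelic F E c 3 := by
    refine ⟨fun _ => Units.map (algebraMap E (AdeleRing (𝓞 E) E) : E →* AdeleRing (𝓞 E) E) (ζ : Eˣ), ?_⟩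
    refine Units.ext ?_
    change _ = (((zR : rational F E c 3 _) : GL (Fin 3) E) : Matrix (Fin 3) (Fin 3) E).map
      (algebraMap E (AdeleRing (𝓞 E) E))
    rw [coe_glDiagonal, hzR, coe_ratCenter, Matrix.smul_one_eq_diagonal, Matrix.diagonal_map (map_zero _)]
    rfl
  set t₀ : {t : rationalTorus F E c 3 //
      cl ⟨((t : torusAdelic F E c 3) : (quasiSplit F E c 3).Adelic), t.2⟩ = i} :=
    ⟨⟨⟨(quasiSplit F E c 3).toAdelic zR, hzT⟩, ⟨zR, rfl⟩⟩, (hcl _).2 (charpoly_toAdelic_ratCenter ζ)⟩ with ht₀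
  rw [tsum_eq_single t₀]
  · intro t ht
    exfalso
    apply ht
    have hct := (hcl ⟨(((t : rationalTorus F E c 3) : torusAdelic F E c 3) : (quasiSplit F E c 3).Adelic),
      (t : rationalTorus F E c 3).2⟩).1 t.2
    have heq := coe_eq_toAdelic_ratCenter_of_charpoly_eq ζ hct
    exact Subtype.ext (Subtype.ext (Subtype.ext heq))

end KernelBorelClass

end UnitaryGroup

end Literature.NumberTheory.Automorphic
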